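import Summits.BirchSwinnertonDyer.Rank1Residual.Additive.RationalLineRamifiedOfTwist
import Summits.BirchSwinnertonDyer.Rank1Residual.Additive.X3BranchGordEndStateOfFacts
import Summits.BirchSwinnertonDyer.Rank1Residual.Additive.X3BranchGordEndStateIntrinsicIsogeny
import Summits.BirchSwinnertonDyer.Rank1Residual.Additive.DisegniLineEndState
import Summits.BirchSwinnertonDyer.Rank1Residual.Additive.DisegniLineEndStateOdd
import Summits.BirchSwinnertonDyer.Rank1Residual.Additive.X3CaseOneMember
import HarnessLib

/-!
# X3♯(G-ord, `e = 2`) at `p ≥ 5`: the END STATES WITHOUT the binder `hram0` — the line datum is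
# (rational line, EVEN, `χ_{p*}`-twist ramified); "ramified at `p`" is a theorem
# (cell `bsd-addord`, seat `bsd-addord-twist`, strategy = twist transport; sequel of
# `RationalLineRamifiedOfTwist.lean`)

HONEST FRAMING (cell `bsd-addord`, `run/shared/lean/pub/bsd-addord/README.md` §4): the programme's
target of record is the full Birch–Swinnerton-Dyer formula for every `E/ℚ` of analytic rank `≤ 1`.
THEOREMS ONLY (no definition, no named fact, no `sorry`): each theorem below is an EXISTING end state
of the tree with ONE per-pair hypothesis deleted; every published input stays an explicit named-fact
binder; nothing is asserted about any curve; nothing is booked (booking is the planner's act).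

## What

`RationalLineRamifiedOfTwist.lean` proves `ClassX3Gord.not_lineUnramifiedAt`: on X3♯(G-ord) ∩ `I₀*` at
`p ≥ 5` EVERY rational `p`-line `Φ₀ ≤ E[p]` is ramified at `p`. Hence the binder
`hram0 : ¬ LineUnramifiedAt W p Φ₀` of the `p ≥ 5` doors is discharged — binder diff `{hram0} ↦ {}`,
all other binders VERBATIM:

* §1 rank `0`: `ClassX3Gord.missingLowerBoundAt_rankZero_of_facts_of_nonAnomalous_ram0Free`,
  `ClassX3Gord.bsdp_rankZero_of_facts_of_nonAnomalous_ram0Free` (p401882's doors: the B-X3G booking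
  sentence at `p ≥ 5`), `ClassX3Gord.missingLowerBoundAt_rankZero_of_facts_intrinsic_ram0Free`,
  `ClassX3Gord.bsdp_rankZero_of_facts_intrinsic_ram0Free` (p404507's doors, anomalous rows included; here
  stated at `p ≥ 5`), `ClassX3Gord.bsdp_of_isIsogenous_of_facts_intrinsic_ram0Free` (p404918: every
  member of the class of a Case-1 member, Cassels).
* §2 rank `1`: `ClassX3Gord.bsdp_rankOne_of_facts_of_cycLineFact_intrinsic_of_branchCoeffOneNeZero{,Odd}_ram0Free`
  (gz's DisegniLine doors p414600 / p417124, `p ≡ 1, 3 (mod 4)`) and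
  `ClassX3Gord.bsdp_rankOne_of_facts_of_delbourgoDatumIntrinsic_of_branchCoeffOneNeZero{,Odd}_ram0Free`
  (S6 p411060).
* §3 the K1 route vocabulary: `caseOneDatum_of_isRationalLine_of_lineEven` — at `p ≥ 5`,
  `CaseOneDatum W' p` (`Additive/X3CaseOneMember.lean`) follows from (rational line, even,
  `χ_{p*}`-twist ramified) on an X3♯(G-ord) ∩ `I₀*` model `W'`; and `hasCaseOneMember_of_…`.

So the per-pair LINE DATUM of every `p ≥ 5` row is exactly the three columns the planner's line-datum
engines certify (`HOME/proof/phi0-p5/README.md`); «hram0 automatic at p ≥ 5» is now kernel-computed.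

References: as in the wrapped files [GreenbergVatsal2000, Wuthrich2014, Delbourgo1998, Delbourgo2002,
Disegni2017, Mazur1972Towers, Miller2011LMS]; Serre 1972 §1.11 [Serre1972]; Silverman *AEC* X.5.4.
-/

set_option autoImplicit false

noncomputable section

open scoped Classical MatrixGroups ModularForm NumberField

open CongruenceSubgroup WeierstrassCurve NumberField IsDedekindDomain Field
  Literature.NumberTheory.EllipticCurves Literature.NumberTheory.EllipticCurves.ModularForms
  Literature.NumberTheory.EllipticCurves.GreenbergVatsal2000
  Literature.NumberTheory.EllipticCurves.Rank1Residual
  Literature.NumberTheory.EllipticCurves.Rank1Residual.Typed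
  Literature.NumberTheory.EllipticCurves.Delbourgo2002
  Literature.NumberTheory.EllipticCurves.Disegni2017
  Literature.NumberTheory.GaloisRepresentations
  Summit.BirchSwinnertonDyer.Rank1Residual.AdditivePotMult
  Summit.BirchSwinnertonDyer.Rank1Residual.Additive.X3Branch

namespace Summit.BirchSwinnertonDyer.Rank1Residual.Additive

variable {W W' : WeierstrassCurve ℚ} [W.IsElliptic] [W.IsGloballyMinimal] [W'.IsElliptic]
  [W'.IsGloballyMinimal] {p : ℕ} [hp : Fact p.Prime]

/-! ## §1 Rank `0` -/

omit [W'.IsElliptic] [W'.IsGloballyMinimal] in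
/-- **p401882's lower-half door at `p ≥ 5` WITHOUT `hram0`** (non-anomalous rows):
`Typed.MissingLowerBoundAt W p` on X3♯(G-ord) ∩ `I₀*` ∩ `r_an = 0` ∩ ¬CM ∩ non-anomalous from the
published facts + the line datum (rational line, EVEN, `χ_{p*}`-twist ramified).
[cite: GreenbergVatsal2000, §2 (11), (16), §3 Thm. (3.12)] [cite: Wuthrich2014, Thm. 16 (p. 397)]
[cite: Delbourgo2002, Theorem (A), (B) (p. 40)] [cite: Serre1972, §1.11 Prop. 11] -/
theorem ClassX3Gord.missingLowerBoundAt_rankZero_of_facts_of_nonAnomalous_ram0Free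
    (hW16 : Wuthrich2014.thm16_halfEigenCharIdeal_dvd_cyclotomicPrime)
    (hGV : thm312_branch_unitContent_and_lambda_eq_residual_goodOrd)
    (h23 : datumSelmer_nonPrimitive_invariants)
    (h414 : Greenberg1999.prop414_noFiniteSubmodule_of_not_dvd_torsionOrder)
    (hGrK : Greenberg1999.imKummer_ge_strictCondition_goodOrdinary)
    (hLiftF : residualEpsilon_surjOn_of_lineRamifiedEven)
    (hDel : Delbourgo2002.mainTheorem)
    (hGZK : rank_eq_analyticRank_of_analyticRank_le_one) (hmod : hasEntireLFunction_rat)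
    (hmodD : nonempty_modularParametrizationData)
    (hX : ClassX3Gord W p) (hcm : ¬ W.HasCM) (hp5 : 5 ≤ p) (he : semistabilityIndex W p = 2)
    (hr : W.analyticRank = 0) (hna : Delbourgo2002.ReductionNonAnomalous W p)
    (Φ₀ : AddSubgroup (W.geomTorsion (p : ℤ))) (hΦ : IsRationalLine W p Φ₀)
    (heven : LineEven W p Φ₀)
    (hram : ∀ (K : Type) [Field K] [NumberField K] [(galRange (K := ℚ) K).Normal],
      Module.finrank ℚ K = 2 → (∃ θ : K, θ ^ 2 = algebraMap ℚ K ((-1) ^ (p / 2) * p)) →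
      ¬ ∀ v : HeightOneSpectrum (𝓞 ℚ), ((p : ℕ) : 𝓞 ℚ) ∈ v.asIdeal →
        ∀ 𝔓 ∈ v.primesAbove, ∀ σ ∈ 𝔓.inertia (absoluteGaloisGroup ℚ), ∀ P ∈ Φ₀,
          σ • P = (if σ ∈ galRange (K := ℚ) K then P else -P)) :
    MissingLowerBoundAt W p :=
  ClassX3Gord.missingLowerBoundAt_rankZero_of_facts_of_nonAnomalous hW16 hGV h23 h414 hGrK hLiftF hDel
    hGZK hmod hmodD hX hcm hp5 he hr hna Φ₀ hΦ
    (RationalLineTwist.ClassX3Gord.not_lineUnramifiedAt hX hp5 he hΦ) heven hram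

omit [W'.IsElliptic] [W'.IsGloballyMinimal] in
/-- **p401882's `BSDp` door at `p ≥ 5` WITHOUT `hram0`** (non-anomalous rows): Miller's `BSD(E,p)` on
X3♯(G-ord) ∩ `I₀*` ∩ `r_an = 0` ∩ ¬CM ∩ non-anomalous from the published facts + the line datum
(rational line, EVEN, `χ_{p*}`-twist ramified). [cite: GreenbergVatsal2000, §2 (11), (16), §3 Thm. (3.12)]
[cite: Wuthrich2014, Thm. 16 (p. 397)] [cite: Delbourgo1998, Prop. 4 (p. 144)]
[cite: Delbourgo2002, Theorem (A), (B) (p. 40)] [cite: Miller2011LMS, Def. 1.1] -/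
theorem ClassX3Gord.bsdp_rankZero_of_facts_of_nonAnomalous_ram0Free
    (hW16 : Wuthrich2014.thm16_halfEigenCharIdeal_dvd_cyclotomicPrime)
    (hGV : thm312_branch_unitContent_and_lambda_eq_residual_goodOrd)
    (h23 : datumSelmer_nonPrimitive_invariants)
    (h414 : Greenberg1999.prop414_noFiniteSubmodule_of_not_dvd_torsionOrder)
    (hGrK : Greenberg1999.imKummer_ge_strictCondition_goodOrdinary)
    (hLiftF : residualEpsilon_surjOn_of_lineRamifiedEven)
    (hDel98 : Delbourgo1998.prop4_rankZero_pow_dvd_constantCoeff) (hDel : Delbourgo2002.mainTheorem)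
    (hGZK : rank_eq_analyticRank_of_analyticRank_le_one) (hmod : hasEntireLFunction_rat)
    (hmodD : nonempty_modularParametrizationData)
    (hX : ClassX3Gord W p) (hcm : ¬ W.HasCM) (hp5 : 5 ≤ p) (he : semistabilityIndex W p = 2)
    (hr : W.analyticRank = 0) (hna : Delbourgo2002.ReductionNonAnomalous W p)
    (Φ₀ : AddSubgroup (W.geomTorsion (p : ℤ))) (hΦ : IsRationalLine W p Φ₀)
    (heven : LineEven W p Φ₀)
    (hram : ∀ (K : Type) [Field K] [NumberField K] [(galRange (K := ℚ) K).Normal],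
      Module.finrank ℚ K = 2 → (∃ θ : K, θ ^ 2 = algebraMap ℚ K ((-1) ^ (p / 2) * p)) →
      ¬ ∀ v : HeightOneSpectrum (𝓞 ℚ), ((p : ℕ) : 𝓞 ℚ) ∈ v.asIdeal →
        ∀ 𝔓 ∈ v.primesAbove, ∀ σ ∈ 𝔓.inertia (absoluteGaloisGroup ℚ), ∀ P ∈ Φ₀,
          σ • P = (if σ ∈ galRange (K := ℚ) K then P else -P)) :
    BSDp W p :=
  ClassX3Gord.bsdp_rankZero_of_facts_of_nonAnomalous hW16 hGV h23 h414 hGrK hLiftF hDel98 hDel hGZK hmod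
    hmodD hX hcm hp5 he hr hna Φ₀ hΦ (RationalLineTwist.ClassX3Gord.not_lineUnramifiedAt hX hp5 he hΦ)
    heven hram

omit [W'.IsElliptic] [W'.IsGloballyMinimal] in
/-- **p404507's lower-half door at `p ≥ 5` WITHOUT `hram0`** (anomalous rows included; `ℓ`-invariant
intrinsic): `Typed.MissingLowerBoundAt W p` on X3♯(G-ord) ∩ `I₀*` ∩ `r_an = 0` from the published facts +
the line datum (rational line, EVEN, `χ_{p*}`-twist ramified).
[cite: GreenbergVatsal2000, §2 (11), (16), §3 Thm. (3.12)] [cite: Wuthrich2014, Thm. 16 (p. 397)]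
[cite: Delbourgo1998, Prop. 4 (p. 144)] [cite: Serre1972, §1.11 Prop. 11] -/
theorem ClassX3Gord.missingLowerBoundAt_rankZero_of_facts_intrinsic_ram0Free
    (hW16 : Wuthrich2014.thm16_halfEigenCharIdeal_dvd_cyclotomicPrime)
    (hGV : thm312_branch_unitContent_and_lambda_eq_residual_goodOrd)
    (h23 : datumSelmer_nonPrimitive_invariants)
    (h414 : Greenberg1999.prop414_noFiniteSubmodule_of_not_dvd_torsionOrder)
    (hGrK : Greenberg1999.imKummer_ge_strictCondition_goodOrdinary)
    (hLiftF : residualEpsilon_surjOn_of_lineRamifiedEven)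
    (hDelG : Delbourgo1998.prop4_rankZero_constantCoeff_eq_unit_mul_of_potGoodOrd)
    (hGZK : rank_eq_analyticRank_of_analyticRank_le_one) (hmod : hasEntireLFunction_rat)
    (hmodD : nonempty_modularParametrizationData)
    (hX : ClassX3Gord W p) (hp5 : 5 ≤ p) (he : semistabilityIndex W p = 2) (hr : W.analyticRank = 0)
    (Φ₀ : AddSubgroup (W.geomTorsion (p : ℤ))) (hΦ : IsRationalLine W p Φ₀)
    (heven : LineEven W p Φ₀)
    (hram : ∀ (K : Type) [Field K] [NumberField K] [(galRange (K := ℚ) K).Normal],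
      Module.finrank ℚ K = 2 → (∃ θ : K, θ ^ 2 = algebraMap ℚ K ((-1) ^ (p / 2) * p)) →
      ¬ ∀ v : HeightOneSpectrum (𝓞 ℚ), ((p : ℕ) : 𝓞 ℚ) ∈ v.asIdeal →
        ∀ 𝔓 ∈ v.primesAbove, ∀ σ ∈ 𝔓.inertia (absoluteGaloisGroup ℚ), ∀ P ∈ Φ₀,
          σ • P = (if σ ∈ galRange (K := ℚ) K then P else -P)) :
    MissingLowerBoundAt W p :=
  ClassX3Gord.missingLowerBoundAt_rankZero_of_facts_intrinsic hW16 hGV h23 h414 hGrK hLiftF hDelG hGZK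
    hmod hmodD hX (by omega) he hr Φ₀ hΦ (RationalLineTwist.ClassX3Gord.not_lineUnramifiedAt hX hp5 he hΦ)
    heven hram

omit [W'.IsElliptic] [W'.IsGloballyMinimal] in
/-- **p404507's `BSDp` door at `p ≥ 5` WITHOUT `hram0`** (anomalous rows included): Miller's `BSD(E,p)`
on X3♯(G-ord) ∩ `I₀*` ∩ `r_an = 0` from the published facts + the line datum (rational line, EVEN,
`χ_{p*}`-twist ramified). [cite: GreenbergVatsal2000, §2 (11), (16), §3 Thm. (3.12)]
[cite: Wuthrich2014, Thm. 16 (p. 397)] [cite: Delbourgo1998, Prop. 4 (p. 144)]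
[cite: Miller2011LMS, Def. 1.1] -/
theorem ClassX3Gord.bsdp_rankZero_of_facts_intrinsic_ram0Free
    (hW16 : Wuthrich2014.thm16_halfEigenCharIdeal_dvd_cyclotomicPrime)
    (hGV : thm312_branch_unitContent_and_lambda_eq_residual_goodOrd)
    (h23 : datumSelmer_nonPrimitive_invariants)
    (h414 : Greenberg1999.prop414_noFiniteSubmodule_of_not_dvd_torsionOrder)
    (hGrK : Greenberg1999.imKummer_ge_strictCondition_goodOrdinary)
    (hLiftF : residualEpsilon_surjOn_of_lineRamifiedEven)
    (hDelG : Delbourgo1998.prop4_rankZero_constantCoeff_eq_unit_mul_of_potGoodOrd)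
    (hDel98 : Delbourgo1998.prop4_rankZero_pow_dvd_constantCoeff)
    (hGZK : rank_eq_analyticRank_of_analyticRank_le_one) (hmod : hasEntireLFunction_rat)
    (hmodD : nonempty_modularParametrizationData)
    (hX : ClassX3Gord W p) (hp5 : 5 ≤ p) (he : semistabilityIndex W p = 2) (hr : W.analyticRank = 0)
    (Φ₀ : AddSubgroup (W.geomTorsion (p : ℤ))) (hΦ : IsRationalLine W p Φ₀)
    (heven : LineEven W p Φ₀)
    (hram : ∀ (K : Type) [Field K] [NumberField K] [(galRange (K := ℚ) K).Normal],
      Module.finrank ℚ K = 2 → (∃ θ : K, θ ^ 2 = algebraMap ℚ K ((-1) ^ (p / 2) * p)) →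
      ¬ ∀ v : HeightOneSpectrum (𝓞 ℚ), ((p : ℕ) : 𝓞 ℚ) ∈ v.asIdeal →
        ∀ 𝔓 ∈ v.primesAbove, ∀ σ ∈ 𝔓.inertia (absoluteGaloisGroup ℚ), ∀ P ∈ Φ₀,
          σ • P = (if σ ∈ galRange (K := ℚ) K then P else -P)) :
    BSDp W p :=
  ClassX3Gord.bsdp_rankZero_of_facts_intrinsic hW16 hGV h23 h414 hGrK hLiftF hDelG hDel98 hGZK hmod
    hmodD hX hp5 he hr Φ₀ hΦ (RationalLineTwist.ClassX3Gord.not_lineUnramifiedAt hX hp5 he hΦ) heven hram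

/-- **p404918's class door at `p ≥ 5` WITHOUT `hram0`**: `BSD(E,p)` for EVERY member `W` of the class of
a Case-1 member `W'` (rational line, EVEN, `χ_{p*}`-twist ramified; `r_an = 0`), by Cassels.
[cite: GreenbergVatsal2000, §2 (11), (16), §3 Thm. (3.12)] [cite: MilneADT2006, Thm. I.7.3]
[cite: Miller2011LMS, Def. 1.1] -/
theorem ClassX3Gord.bsdp_of_isIsogenous_of_facts_intrinsic_ram0Free
    (hCassels : bsdRHS_eq_of_isIsogenous)
    (hW16 : Wuthrich2014.thm16_halfEigenCharIdeal_dvd_cyclotomicPrime)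
    (hGV : thm312_branch_unitContent_and_lambda_eq_residual_goodOrd)
    (h23 : datumSelmer_nonPrimitive_invariants)
    (h414 : Greenberg1999.prop414_noFiniteSubmodule_of_not_dvd_torsionOrder)
    (hGrK : Greenberg1999.imKummer_ge_strictCondition_goodOrdinary)
    (hLiftF : residualEpsilon_surjOn_of_lineRamifiedEven)
    (hDelG : Delbourgo1998.prop4_rankZero_constantCoeff_eq_unit_mul_of_potGoodOrd)
    (hDel98 : Delbourgo1998.prop4_rankZero_pow_dvd_constantCoeff)
    (hGZK : rank_eq_analyticRank_of_analyticRank_le_one) (hmod : hasEntireLFunction_rat)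
    (hmodD : nonempty_modularParametrizationData)
    (hiso : IsIsogenous W W')
    (hX' : ClassX3Gord W' p) (hp5 : 5 ≤ p) (he' : semistabilityIndex W' p = 2) (hr' : W'.analyticRank = 0)
    (Φ₀ : AddSubgroup (W'.geomTorsion (p : ℤ))) (hΦ : IsRationalLine W' p Φ₀)
    (heven : LineEven W' p Φ₀)
    (hram : ∀ (K : Type) [Field K] [NumberField K] [(galRange (K := ℚ) K).Normal],
      Module.finrank ℚ K = 2 → (∃ θ : K, θ ^ 2 = algebraMap ℚ K ((-1) ^ (p / 2) * p)) →
      ¬ ∀ v : HeightOneSpectrum (𝓞 ℚ), ((p : ℕ) : 𝓞 ℚ) ∈ v.asIdeal →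
        ∀ 𝔓 ∈ v.primesAbove, ∀ σ ∈ 𝔓.inertia (absoluteGaloisGroup ℚ), ∀ P ∈ Φ₀,
          σ • P = (if σ ∈ galRange (K := ℚ) K then P else -P)) :
    BSDp W p :=
  ClassX3Gord.bsdp_of_isIsogenous_of_facts_intrinsic hCassels hW16 hGV h23 h414 hGrK hLiftF hDelG hDel98
    hGZK hmod hmodD hiso hX' hp5 he' hr' Φ₀ hΦ
    (RationalLineTwist.ClassX3Gord.not_lineUnramifiedAt hX' hp5 he' hΦ) heven hram

/-! ## §2 Rank `1` -/

omit [W'.IsElliptic] [W'.IsGloballyMinimal] in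
/-- **gz's DisegniLine door, EVEN branch (`p ≡ 1 (mod 4)`), WITHOUT `hram0`**: Miller's `BSD(E,p)` on
X3♯(G-ord) ∩ `I₀*` ∩ `r_an = 1` ∩ ¬CM from the published facts (Disegni cyc-line GZ `hCyc`, Mazur
`hMaz`, …) + the line datum (rational line, EVEN, `χ_{p*}`-twist ramified) + `A′ ≠ 0`.
[cite: Disegni2017, Theorem B] [cite: Mazur1972Towers, Cor. 5.15] [cite: Delbourgo2002, Theorem (A), (B) (p. 40)]
[cite: GreenbergVatsal2000, §2 (11), (16), §3 Thm. (3.12)] [cite: Miller2011LMS, Def. 1.1] -/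
theorem ClassX3Gord.bsdp_rankOne_of_facts_of_cycLineFact_intrinsic_of_branchCoeffOneNeZero_ram0Free
    (hW16 : Wuthrich2014.thm16_halfEigenCharIdeal_dvd_cyclotomicPrime)
    (hGV : thm312_branch_unitContent_and_lambda_eq_residual_goodOrd)
    (h23 : datumSelmer_nonPrimitive_invariants)
    (h414 : Greenberg1999.prop414_noFiniteSubmodule_of_not_dvd_torsionOrder)
    (hGrK : Greenberg1999.imKummer_ge_strictCondition_goodOrdinary)
    (hLiftF : residualEpsilon_surjOn_of_lineRamifiedEven)
    (hMaz : Mazur1972.cor515_universalNormIndex)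
    (hCyc : delbourgoDatum_cycLineGrossZagier)
    (hArt : rankinSelbergEulerProductHecke_baseChangeDirichlet_eq) (h73 : GrossZagier1986_thm_I_7_3)
    (hWald : waldspurger_exists_heegnerField_twist_ne_zero)
    (hDel : Delbourgo2002.mainTheorem) (hmod : hasEntireLFunction_rat)
    (hmodD : nonempty_modularParametrizationData) (hmodN : exists_isNewformOf)
    (hGZK : rank_eq_analyticRank_of_analyticRank_le_one)
    (hX : ClassX3Gord W p) (he : semistabilityIndex W p = 2) (hp4 : p % 4 = 1) (hcm : ¬ W.HasCM)
    (hr : W.analyticRank = 1)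
    (Φ₀ : AddSubgroup (W.geomTorsion (p : ℤ))) (hΦ : IsRationalLine W p Φ₀)
    (heven : LineEven W p Φ₀)
    (hram : ∀ (K : Type) [Field K] [NumberField K] [(galRange (K := ℚ) K).Normal],
      Module.finrank ℚ K = 2 → (∃ θ : K, θ ^ 2 = algebraMap ℚ K ((-1) ^ (p / 2) * p)) →
      ¬ ∀ v : HeightOneSpectrum (𝓞 ℚ), ((p : ℕ) : 𝓞 ℚ) ∈ v.asIdeal →
        ∀ 𝔓 ∈ v.primesAbove, ∀ σ ∈ 𝔓.inertia (absoluteGaloisGroup ℚ), ∀ P ∈ Φ₀,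
          σ • P = (if σ ∈ galRange (K := ℚ) K then P else -P))
    (hne : BranchCoeffOneNeZeroAt W p) : BSDp W p :=
  ClassX3Gord.bsdp_rankOne_of_facts_of_cycLineFact_intrinsic_of_branchCoeffOneNeZero hW16 hGV h23 h414
    hGrK hLiftF hMaz hCyc hArt h73 hWald hDel hmod hmodD hmodN hGZK hX he hp4 hcm hr Φ₀ hΦ
    (RationalLineTwist.ClassX3Gord.not_lineUnramifiedAt hX (by have h2 := hp.out.two_le; omega) he hΦ)
    heven hram hne

omit [W'.IsElliptic] [W'.IsGloballyMinimal] in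
/-- **gz's DisegniLine door, ODD branch (`p ≡ 3 (mod 4)`, `p ≥ 5`), WITHOUT `hram0`**: Miller's
`BSD(E,p)` on X3♯(G-ord) ∩ `I₀*` ∩ `r_an = 1` ∩ ¬CM from the published facts + the line datum (rational
line, EVEN, `χ_{p*}`-twist ramified) + `A′ ≠ 0`. [cite: Disegni2017, Theorem B]
[cite: Mazur1972Towers, Cor. 5.15] [cite: Delbourgo2002, Theorem (A), (B) (p. 40)]
[cite: GreenbergVatsal2000, §2 (11), (16), §3 Thm. (3.12)] [cite: Miller2011LMS, Def. 1.1] -/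
theorem ClassX3Gord.bsdp_rankOne_of_facts_of_cycLineFact_intrinsic_of_branchCoeffOneNeZeroOdd_ram0Free
    (hW16 : Wuthrich2014.thm16_halfEigenCharIdeal_dvd_cyclotomicPrime)
    (hGV : thm312_branch_unitContent_and_lambda_eq_residual_goodOrd)
    (h23 : datumSelmer_nonPrimitive_invariants)
    (h414 : Greenberg1999.prop414_noFiniteSubmodule_of_not_dvd_torsionOrder)
    (hGrK : Greenberg1999.imKummer_ge_strictCondition_goodOrdinary)
    (hLiftF : residualEpsilon_surjOn_of_lineRamifiedEven)
    (hMaz : Mazur1972.cor515_universalNormIndex)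
    (hCyc : delbourgoDatum_cycLineGrossZagier)
    (hArt : rankinSelbergEulerProductHecke_baseChangeDirichlet_eq) (h73 : GrossZagier1986_thm_I_7_3)
    (hWald : waldspurger_exists_heegnerField_twist_ne_zero)
    (hDel : Delbourgo2002.mainTheorem) (hmod : hasEntireLFunction_rat)
    (hmodD : nonempty_modularParametrizationData) (hmodN : exists_isNewformOf)
    (hGZK : rank_eq_analyticRank_of_analyticRank_le_one)
    (hX : ClassX3Gord W p) (he : semistabilityIndex W p = 2) (hp4 : p % 4 = 3) (hp5 : 5 ≤ p)
    (hcm : ¬ W.HasCM)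
    (hr : W.analyticRank = 1)
    (Φ₀ : AddSubgroup (W.geomTorsion (p : ℤ))) (hΦ : IsRationalLine W p Φ₀)
    (heven : LineEven W p Φ₀)
    (hram : ∀ (K : Type) [Field K] [NumberField K] [(galRange (K := ℚ) K).Normal],
      Module.finrank ℚ K = 2 → (∃ θ : K, θ ^ 2 = algebraMap ℚ K ((-1) ^ (p / 2) * p)) →
      ¬ ∀ v : HeightOneSpectrum (𝓞 ℚ), ((p : ℕ) : 𝓞 ℚ) ∈ v.asIdeal →
        ∀ 𝔓 ∈ v.primesAbove, ∀ σ ∈ 𝔓.inertia (absoluteGaloisGroup ℚ), ∀ P ∈ Φ₀,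
          σ • P = (if σ ∈ galRange (K := ℚ) K then P else -P))
    (hne : BranchCoeffOneNeZeroAt W p) : BSDp W p :=
  ClassX3Gord.bsdp_rankOne_of_facts_of_cycLineFact_intrinsic_of_branchCoeffOneNeZeroOdd hW16 hGV h23 h414
    hGrK hLiftF hMaz hCyc hArt h73 hWald hDel hmod hmodD hmodN hGZK hX he hp4 hp5 hcm hr Φ₀ hΦ
    (RationalLineTwist.ClassX3Gord.not_lineUnramifiedAt hX hp5 he hΦ) heven hram hne

omit [W'.IsElliptic] [W'.IsGloballyMinimal] in
/-- **S6's end state, EVEN branch (`p ≡ 1 (mod 4)`), WITHOUT `hram0`**: Miller's `BSD(E,p)` on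
X3♯(G-ord) ∩ `I₀*` ∩ `r_an = 1` ∩ ¬CM from the published facts + the displayed Delbourgo datum in the
INTRINSIC currency (`hDatum`) + the line datum (rational line, EVEN, `χ_{p*}`-twist ramified) + `A′ ≠ 0`.
[cite: Delbourgo2002, Theorem (A), (B) (p. 40) with p. 67 (iv), p. 69] [cite: Mazur1972Towers, Cor. 5.15]
[cite: GreenbergVatsal2000, §2 (11), (16), §3 Thm. (3.12)] [cite: Miller2011LMS, Def. 1.1] -/
theorem ClassX3Gord.bsdp_rankOne_of_facts_of_delbourgoDatumIntrinsic_of_branchCoeffOneNeZero_ram0Free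
    (hW16 : Wuthrich2014.thm16_halfEigenCharIdeal_dvd_cyclotomicPrime)
    (hGV : thm312_branch_unitContent_and_lambda_eq_residual_goodOrd)
    (h23 : datumSelmer_nonPrimitive_invariants)
    (h414 : Greenberg1999.prop414_noFiniteSubmodule_of_not_dvd_torsionOrder)
    (hGrK : Greenberg1999.imKummer_ge_strictCondition_goodOrdinary)
    (hLiftF : residualEpsilon_surjOn_of_lineRamifiedEven)
    (hMaz : Mazur1972.cor515_universalNormIndex) (hDel : Delbourgo2002.mainTheorem)
    (hmod : hasEntireLFunction_rat) (hmodD : nonempty_modularParametrizationData)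
    (hGZK : rank_eq_analyticRank_of_analyticRank_le_one)
    (hX : ClassX3Gord W p) (he : semistabilityIndex W p = 2) (hp4 : p % 4 = 1) (hcm : ¬ W.HasCM)
    (hr : W.analyticRank = 1)
    (hDatum : ∃ Dh : PAdicHeightData W p,
      LeadingTermClausesIntrinsic W p Dh ∧ TwistedBranchGrossZagierAt W p Dh)
    (Φ₀ : AddSubgroup (W.geomTorsion (p : ℤ))) (hΦ : IsRationalLine W p Φ₀)
    (heven : LineEven W p Φ₀)
    (hram : ∀ (K : Type) [Field K] [NumberField K] [(galRange (K := ℚ) K).Normal],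
      Module.finrank ℚ K = 2 → (∃ θ : K, θ ^ 2 = algebraMap ℚ K ((-1) ^ (p / 2) * p)) →
      ¬ ∀ v : HeightOneSpectrum (𝓞 ℚ), ((p : ℕ) : 𝓞 ℚ) ∈ v.asIdeal →
        ∀ 𝔓 ∈ v.primesAbove, ∀ σ ∈ 𝔓.inertia (absoluteGaloisGroup ℚ), ∀ P ∈ Φ₀,
          σ • P = (if σ ∈ galRange (K := ℚ) K then P else -P))
    (hne : BranchCoeffOneNeZeroAt W p) : BSDp W p :=
  ClassX3Gord.bsdp_rankOne_of_facts_of_delbourgoDatumIntrinsic_of_branchCoeffOneNeZero hW16 hGV h23 h414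
    hGrK hLiftF hMaz hDel hmod hmodD hGZK hX he hp4 hcm hr hDatum Φ₀ hΦ
    (RationalLineTwist.ClassX3Gord.not_lineUnramifiedAt hX (by have h2 := hp.out.two_le; omega) he hΦ)
    heven hram hne

omit [W'.IsElliptic] [W'.IsGloballyMinimal] in
/-- **S6's end state, ODD branch (`p ≡ 3 (mod 4)`, `p ≥ 5`), WITHOUT `hram0`**: Miller's `BSD(E,p)` on
X3♯(G-ord) ∩ `I₀*` ∩ `r_an = 1` ∩ ¬CM from the published facts + the displayed Delbourgo datum in the
INTRINSIC currency (`hDatum`) + the line datum (rational line, EVEN, `χ_{p*}`-twist ramified) + `A′ ≠ 0`.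
[cite: Delbourgo2002, Theorem (A), (B) (p. 40) with p. 67 (iv), p. 69] [cite: Mazur1972Towers, Cor. 5.15]
[cite: GreenbergVatsal2000, §2 (11), (16), §3 Thm. (3.12)] [cite: Miller2011LMS, Def. 1.1] -/
theorem ClassX3Gord.bsdp_rankOne_of_facts_of_delbourgoDatumIntrinsic_of_branchCoeffOneNeZeroOdd_ram0Free
    (hW16 : Wuthrich2014.thm16_halfEigenCharIdeal_dvd_cyclotomicPrime)
    (hGV : thm312_branch_unitContent_and_lambda_eq_residual_goodOrd)
    (h23 : datumSelmer_nonPrimitive_invariants)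
    (h414 : Greenberg1999.prop414_noFiniteSubmodule_of_not_dvd_torsionOrder)
    (hGrK : Greenberg1999.imKummer_ge_strictCondition_goodOrdinary)
    (hLiftF : residualEpsilon_surjOn_of_lineRamifiedEven)
    (hMaz : Mazur1972.cor515_universalNormIndex) (hDel : Delbourgo2002.mainTheorem)
    (hmod : hasEntireLFunction_rat) (hmodD : nonempty_modularParametrizationData)
    (hGZK : rank_eq_analyticRank_of_analyticRank_le_one)
    (hX : ClassX3Gord W p) (he : semistabilityIndex W p = 2) (hp4 : p % 4 = 3) (hp5 : 5 ≤ p)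
    (hcm : ¬ W.HasCM) (hr : W.analyticRank = 1)
    (hDatum : ∃ Dh : PAdicHeightData W p,
      LeadingTermClausesIntrinsic W p Dh ∧ TwistedBranchGrossZagierAt W p Dh)
    (Φ₀ : AddSubgroup (W.geomTorsion (p : ℤ))) (hΦ : IsRationalLine W p Φ₀)
    (heven : LineEven W p Φ₀)
    (hram : ∀ (K : Type) [Field K] [NumberField K] [(galRange (K := ℚ) K).Normal],
      Module.finrank ℚ K = 2 → (∃ θ : K, θ ^ 2 = algebraMap ℚ K ((-1) ^ (p / 2) * p)) →
      ¬ ∀ v : HeightOneSpectrum (𝓞 ℚ), ((p : ℕ) : 𝓞 ℚ) ∈ v.asIdeal →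
        ∀ 𝔓 ∈ v.primesAbove, ∀ σ ∈ 𝔓.inertia (absoluteGaloisGroup ℚ), ∀ P ∈ Φ₀,
          σ • P = (if σ ∈ galRange (K := ℚ) K then P else -P))
    (hne : BranchCoeffOneNeZeroAt W p) : BSDp W p :=
  ClassX3Gord.bsdp_rankOne_of_facts_of_delbourgoDatumIntrinsic_of_branchCoeffOneNeZeroOdd hW16 hGV h23
    h414 hGrK hLiftF hMaz hDel hmod hmodD hGZK hX he hp4 hp5 hcm hr hDatum Φ₀ hΦ
    (RationalLineTwist.ClassX3Gord.not_lineUnramifiedAt hX hp5 he hΦ) heven hram hne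

/-! ## §3 The K1 route vocabulary `CaseOneDatum` at `p ≥ 5` -/

omit [W.IsElliptic] [W.IsGloballyMinimal] in
/-- **`CaseOneDatum` at `p ≥ 5` from three columns.** On an X3♯(G-ord) ∩ `I₀*` model `W'` at `p ≥ 5`
a rational `p`-line that is EVEN and whose `χ_{p*}`-twist is ramified IS a Case-1 datum
(`Additive/X3CaseOneMember.lean`): its ramification at `p` is `ClassX3Gord.not_lineUnramifiedAt`.
[cite: GreenbergVatsal2000, §2 p. 28] [cite: Serre1972, §1.11 Prop. 11] -/
theorem caseOneDatum_of_isRationalLine_of_lineEven (hX' : ClassX3Gord W' p) (hp5 : 5 ≤ p)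
    (he' : semistabilityIndex W' p = 2)
    (Φ₀ : AddSubgroup (W'.geomTorsion (p : ℤ))) (hΦ : IsRationalLine W' p Φ₀) (heven : LineEven W' p Φ₀)
    (hram : ∀ (K : Type) [Field K] [NumberField K] [(galRange (K := ℚ) K).Normal],
      Module.finrank ℚ K = 2 → (∃ θ : K, θ ^ 2 = algebraMap ℚ K ((-1) ^ (p / 2) * p)) →
      ¬ ∀ v : HeightOneSpectrum (𝓞 ℚ), ((p : ℕ) : 𝓞 ℚ) ∈ v.asIdeal →
        ∀ 𝔓 ∈ v.primesAbove, ∀ σ ∈ 𝔓.inertia (Field.absoluteGaloisGroup ℚ), ∀ P ∈ Φ₀,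
          σ • P = (if σ ∈ galRange (K := ℚ) K then P else -P)) :
    CaseOneDatum W' p :=
  Or.inr ⟨hp5, Φ₀, hΦ, RationalLineTwist.ClassX3Gord.not_lineUnramifiedAt hX' hp5 he' hΦ, heven, hram⟩

omit [W.IsElliptic] [W.IsGloballyMinimal] in
/-- **`HasCaseOneMember` at `p ≥ 5` from three columns on an isogenous model.** [cite: GreenbergVatsal2000, §2 p. 28]
[cite: MilneADT2006, Thm. I.7.3] -/
theorem hasCaseOneMember_of_isRationalLine_of_lineEven (hiso : IsIsogenous W W')
    (hX' : ClassX3Gord W' p) (hp5 : 5 ≤ p) (he' : semistabilityIndex W' p = 2)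
    (Φ₀ : AddSubgroup (W'.geomTorsion (p : ℤ))) (hΦ : IsRationalLine W' p Φ₀) (heven : LineEven W' p Φ₀)
    (hram : ∀ (K : Type) [Field K] [NumberField K] [(galRange (K := ℚ) K).Normal],
      Module.finrank ℚ K = 2 → (∃ θ : K, θ ^ 2 = algebraMap ℚ K ((-1) ^ (p / 2) * p)) →
      ¬ ∀ v : HeightOneSpectrum (𝓞 ℚ), ((p : ℕ) : 𝓞 ℚ) ∈ v.asIdeal →
        ∀ 𝔓 ∈ v.primesAbove, ∀ σ ∈ 𝔓.inertia (Field.absoluteGaloisGroup ℚ), ∀ P ∈ Φ₀,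
          σ • P = (if σ ∈ galRange (K := ℚ) K then P else -P)) :
    HasCaseOneMember W p :=
  ⟨W', ‹_›, ‹_›, hiso, hX', he', caseOneDatum_of_isRationalLine_of_lineEven hX' hp5 he' Φ₀ hΦ heven hram⟩

end Summit.BirchSwinnertonDyer.Rank1Residual.Additive

end
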